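import Literature.MathematicalPhysics.QuantumLattice.HubbardScaleReportCT

/-!
# Crux `SeededBrokenRegimeBoseFermiPinned` (stmt-HubbardSuperconductivity-14047), line `seed-strength-flow` — stub `stub_quadraticFormKernelFour` (N1)

WHAT. The quadratic quasiparticle form `𝒬(q) = normalFormQuadratic L M β q` of a hidden normal form
`q` (`Literature/MathematicalPhysics/QuantumLattice/HubbardScaleReport.lean`) is a `ℂ`-linear
combination of products of TWO Grassmann generators `ψ(A)ψ(B)`, so all its `4`-point kernels
(`kernel ℂ 𝒬(q) 4 X = (4!)⁻¹ · constPart (∂_{X₃}∂_{X₂}∂_{X₁}∂_{X₀} 𝒬(q))`,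
`Literature/MathematicalPhysics/QuantumLattice/GrassmannKernels.lean`) vanish: the first two
derivatives reduce `ψ(A)ψ(B)` to a scalar (`grassmannDeriv_grassmannDeriv_gen_mul_gen`), the third
kills it (`grassmannDeriv_one`).

SOURCE: folklore (degree count in a finite-dimensional Grassmann algebra).

The file proves, in the sub-namespace `QuadraticFormKernelFour`, the generic facts
`iterDeriv_four_apply` (unfolding four iterated derivatives) and `constPart_iterDeriv_four_gen_mul_gen`
(`constPart (iterDeriv X (ψ(A)ψ(B))) = 0` for `X : Fin 4 → Γ`), then
`constPart_iterDeriv_four_normalFormQuadratic` (the `constPart ∘ iterDeriv` form — the shape used by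
`cooperVertex`) by linearity, and finally the registered stub.
-/

set_option linter.dupNamespace false -- Summit.<S>.<S> doubles the summit name (tree convention)

namespace Summit.HubbardSuperconductivity.HubbardSuperconductivity.Theorems.AposterioriCapRgSeededBrokenRegimeBoseFermiPinned

open Literature.MathematicalPhysics.QuantumLattice Literature.Probability.LatticeModels GrassmannAlgebra

namespace QuadraticFormKernelFour

/-! ### Generic: four derivatives kill a product of two generators -/

section Generic

variable (R : Type*) [CommRing R] {Γ : Type*}

/-- Four iterated derivatives, unfolded: `iterDeriv (X₀,X₁,X₂,X₃) F = ∂_{X₃} (∂_{X₂} (∂_{X₁} (∂_{X₀} F)))`.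
[folklore] -/
theorem iterDeriv_four_apply (X : Fin 4 → Γ) (F : GrassmannAlgebra R Γ) :
    iterDeriv R X F = grassmannDeriv R (X 3) (grassmannDeriv R (X 2)
      (grassmannDeriv R (X 1) (grassmannDeriv R (X 0) F))) := by
  simp only [iterDeriv, List.ofFn_succ, Fin.isValue, Fin.succ_zero_eq_one, Fin.succ_one_eq_two,
    Fin.reduceSucc, List.ofFn_zero, List.reverse_cons, List.reverse_nil, List.nil_append,
    List.cons_append, List.prod_cons, List.prod_nil, mul_one, Module.End.mul_apply]

/-- A product of two generators has no `4`-point coefficient: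
`constPart (∂_{X₃}∂_{X₂}∂_{X₁}∂_{X₀} (ψ(A)ψ(B))) = 0` — two derivatives give the scalar
`δ_{X₀A}δ_{X₁B} - δ_{X₀B}δ_{X₁A}`, the third derivative kills it. [folklore] -/
theorem constPart_iterDeriv_four_gen_mul_gen [DecidableEq Γ] (X : Fin 4 → Γ) (A B : Γ) :
    constPart R (iterDeriv R X (gen R A * gen R B)) = 0 := by
  rw [iterDeriv_four_apply, grassmannDeriv_grassmannDeriv_gen_mul_gen]
  split_ifs <;> simp

end Generic

/-! ### The quadratic quasiparticle form has no quartic coefficient -/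

/-- `constPart (iterDeriv X 𝒬(q)) = 0` for every `X : Fin 4 → HubbardFieldIdx L M`: the quadratic
quasiparticle form `𝒬(q) = normalFormQuadratic L M β q` is a `ℂ`-linear combination of the products
`ψ⁺ψ⁻`, `ψ⁺ψ⁺`, `ψ⁻ψ⁻` of two generators, each killed by `constPart_iterDeriv_four_gen_mul_gen`
(this is the `constPart ∘ iterDeriv` shape entering `cooperVertex`). [folklore] -/
theorem constPart_iterDeriv_four_normalFormQuadratic (L M : ℕ) {Np : ℕ} [NeZero L] (β : ℝ)
    (q : HubbardNormalForm L Np) (X : Fin 4 → HubbardFieldIdx L M) :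
    constPart ℂ (iterDeriv ℂ X (normalFormQuadratic L M β q)) = 0 := by
  rw [normalFormQuadratic, map_sum, map_sum]
  refine Finset.sum_eq_zero fun k _ => ?_
  simp only [psiPlus, psiMinus, map_add, map_smul, smul_eq_mul,
    constPart_iterDeriv_four_gen_mul_gen, mul_zero, add_zero]

end QuadraticFormKernelFour

/-! ### N1 -/

/-- **N1 (`QuadraticFormKernelFour`)**: the quadratic quasiparticle form `𝒬(q) = normalFormQuadratic
L M β q` of every hidden normal form `q` contributes nothing to `4`-point kernels:
`kernel ℂ 𝒬(q) 4 X = 0` for all `X`. [folklore] -/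
theorem stub_quadraticFormKernelFour :
    ∀ (L M Np : ℕ) [NeZero L] (β : ℝ) (q : HubbardNormalForm L Np) (X : Fin 4 → HubbardFieldIdx L M),
      kernel ℂ (normalFormQuadratic L M β q) 4 X = 0 := by
  intro L M Np _ β q X
  rw [kernel_def, QuadraticFormKernelFour.constPart_iterDeriv_four_normalFormQuadratic, mul_zero]

end Summit.HubbardSuperconductivity.HubbardSuperconductivity.Theorems.AposterioriCapRgSeededBrokenRegimeBoseFermiPinned
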